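import Literature.AnabelianGeometry.SemiGraphs.TemperedAnabelianThm66SubProofs
import Literature.AnabelianGeometry.SemiGraphs.TemperedPiNormalizersOfDelta
import HarnessLib

/-!
# [SemiAnbd] Theorem 6.6 with its Lemma 6.1 input in the PRINTED form «(iii) from (ii) = [André] Cor. 6.2.2»

Mochizuki, *Semi-graphs of anabelioids*, Publ. RIMS **42** (2006) [SemiAnbd], §6, Theorem 6.6 (Tempered
and Profinite Outer Isomorphisms), author's manuscript pp. 72–73; the uniqueness step of its proof, p. 73:
«That such a `β` is unique, up to inner automorphism, follows from Lemma 6.1, (iii)», and Lemma 6.1,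
p. 69: «Assertion (iii) follows immediately from assertion (ii)» [= [André] Cor. 6.2.2].
[cite: MochizukiSemiAnbd2006, Thm 6.6 pp.72-73] [cite: MochizukiSemiAnbd2006, Lem 6.1(ii)-(iii) p.69]

PROOF-ONLY companion (abc-iut cell, block F fact-proving wave, seat abc-iut-f-174, FACT-LIST row F-1707
`TemperedOrigin.ProfiniteOuterIsoLiftsHolds`; theorems only — no `def`, no `instance`, no new named fact).
The tree reduces the typed Thm. 6.6 to the specialisation isomorphism systems of its printed proof plus
Lemma 6.1 (iii) (abc-iut-w5-d240: `TemperedCurve.profiniteOuterIsoLifts_of_system`,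
`TemperedOrigin.profiniteOuterIsoLiftsHolds_of`), and Lemma 6.1 (iii) either to the fact
`ProfiniteNormalizersHolds` itself or to the André TOWER input (`…_of_tower`).  Composing with
`TemperedPiNormalizersOfDelta.lean` (Lemma 6.1 (iii) DERIVED from (ii) + exactness of the completed
sequence, abc-iut-f-174) gives the reduction in which the Lemma 6.1 input enters exactly as print cites
it — Lemma 6.1 (ii) = [André] Cor. 6.2.2 for the target curve `Y` (binder `Y.DeltaTempNormallyTerminal`),
with `Π^temp_{Y_L}` tempered and Galois-countable:

* `TemperedCurve.profiniteOuterIsoLifts_of_system_of_deltaTempNormallyTerminal` (curve level),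
* `TemperedOrigin.profiniteOuterIsoLiftsHolds_of_system_of_deltaTempNormallyTerminal` /
  `…_of_system_of_groupLevelData` (origin-quantified; the FACT-LIST row F-1707 modulo
  {`SpecializationIsoSystemHolds`, [André] Cor. 6.2.2, `IsTempered` + first countable / `GroupLevelData`}).

HONEST FRAMING.  Bookkeeping composition of landed theorems; the specialisation isomorphism systems
([Mzk3] Lem. 2.3, [SemiAnbd] §3, Ex. 5.6 / Rmk. 5.6.1) and [André] Cor. 6.2.2 are INPUTS, not proved;
nothing here concerns the disputed parts of inter-universal Teichmüller theory or takes a side on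
[IUTchIII] Cor. 3.12; typed ≠ proved.
-/

noncomputable section

namespace Literature.AnabelianGeometry.SemiGraphs

namespace TemperedCurve

variable {p : ℕ} [Fact p.Prime]

/-- **[SemiAnbd] Thm. 6.6 for the pair `(X, Y)`** — the typed node `X.ProfiniteOuterIsoLifts Y` — from the
specialisation isomorphism systems attached to the `α̂ : Π_{X_K} ⥲ Π_{Y_L}` (rows L02–L07 of its printed
proof) and, for the uniqueness step, Lemma 6.1 (ii) for `Y` (= [André] Cor. 6.2.2, binder `hii`) with
`Π^temp_{Y_L}` tempered and Galois-countable: Lemma 6.1 (iii) for `Y` is DERIVED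
(`piTempNormallyTerminal_of_deltaTempNormallyTerminal`, exactness `ker_augHat_eq_deltaHat_of_isTempered`).
[cite: MochizukiSemiAnbd2006, Thm 6.6 pp.72-73] -/
theorem profiniteOuterIsoLifts_of_system_of_deltaTempNormallyTerminal {X Y : TemperedCurve p}
    (hS : ∀ αhat : X.PiHat ≃ₜ* Y.PiHat, Nonempty (SpecializationIsoSystem X Y αhat))
    (hT : IsTempered Y.PiTemp) [FirstCountableTopology Y.PiTemp] (hii : Y.DeltaTempNormallyTerminal) :
    X.ProfiniteOuterIsoLifts Y :=
  profiniteOuterIsoLifts_of_system hS (Y.profiniteNormalizers_of_deltaTempNormallyTerminal hT hii).2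

/-- **[SemiAnbd] Thm. 6.6 for the pair `(X, Y)`** from the specialisation isomorphism systems and Lemma
6.1 (ii) for `Y` (= [André] Cor. 6.2.2), `Y` carrying the parameter bundle `d : Y.GroupLevelData`
(tempered, Galois-countable, …). [cite: MochizukiSemiAnbd2006, Thm 6.6 pp.72-73] -/
theorem profiniteOuterIsoLifts_of_system_of_groupLevelData {X Y : TemperedCurve p}
    (hS : ∀ αhat : X.PiHat ≃ₜ* Y.PiHat, Nonempty (SpecializationIsoSystem X Y αhat))
    (d : Y.GroupLevelData) (hii : Y.DeltaTempNormallyTerminal) : X.ProfiniteOuterIsoLifts Y :=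
  profiniteOuterIsoLifts_of_system hS
    (Y.profiniteNormalizers_of_deltaTempNormallyTerminal_of_groupLevelData d hii).2

end TemperedCurve

namespace TemperedOrigin

variable {p : ℕ} [Fact p.Prime]

/-- **[SemiAnbd] Thm. 6.6 as printed** (origin-quantified; the FACT-LIST row F-1707
`Ω.ProfiniteOuterIsoLiftsHolds`) REDUCED TO ITS PRINTED INPUTS with Lemma 6.1 entering as print cites it:
the specialisation isomorphism systems of the proof (`Ω.SpecializationIsoSystemHolds`: [Mzk3] Lem. 2.3,
[SemiAnbd] §3, Ex. 5.6 / Rmk. 5.6.1) and, for every certified curve, «`Π^temp` tempered,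
Galois-countable» together with Lemma 6.1 (ii) `N_{Δ_X}(Δ^temp_X) = Δ^temp_X` (= [André] Cor. 6.2.2) —
Lemma 6.1 (iii) being derived (`profiniteNormalizersHolds_of_deltaTempNormallyTerminal`) and consumed by
w5-d240's `profiniteOuterIsoLiftsHolds_of`. [cite: MochizukiSemiAnbd2006, Thm 6.6 pp.72-73] -/
theorem profiniteOuterIsoLiftsHolds_of_system_of_deltaTempNormallyTerminal (Ω : TemperedOrigin p)
    (hS : Ω.SpecializationIsoSystemHolds)
    (h : ∀ X : TemperedCurve p, Ω.IsHyperbolicCurveOrigin X →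
      IsTempered X.PiTemp ∧ FirstCountableTopology X.PiTemp ∧ X.DeltaTempNormallyTerminal) :
    Ω.ProfiniteOuterIsoLiftsHolds :=
  Ω.profiniteOuterIsoLiftsHolds_of hS (Ω.profiniteNormalizersHolds_of_deltaTempNormallyTerminal h)

/-- **[SemiAnbd] Thm. 6.6 as printed** from the specialisation isomorphism systems, the parameter bundle
`GroupLevelData` of the certified curves, and Lemma 6.1 (ii) (= [André] Cor. 6.2.2) for them.
[cite: MochizukiSemiAnbd2006, Thm 6.6 pp.72-73] -/
theorem profiniteOuterIsoLiftsHolds_of_system_of_groupLevelData (Ω : TemperedOrigin p)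
    (hS : Ω.SpecializationIsoSystemHolds)
    (h : ∀ X : TemperedCurve p, Ω.IsHyperbolicCurveOrigin X →
      Nonempty X.GroupLevelData ∧ X.DeltaTempNormallyTerminal) :
    Ω.ProfiniteOuterIsoLiftsHolds :=
  Ω.profiniteOuterIsoLiftsHolds_of hS
    (Ω.profiniteNormalizersHolds_of_groupLevelData_of_deltaTempNormallyTerminal h)

/-- **The three TemperedOrigin FACT rows of [SemiAnbd] Lem. 6.1 (ii)(iii) / Thm. 6.6 together** (F-1706
`ProfiniteNormalizersHolds` and F-1707 `ProfiniteOuterIsoLiftsHolds`) from ONE list of printed inputs on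
the certified curves: specialisation isomorphism systems, `Π^temp` tempered + Galois-countable, and
[André] Cor. 6.2.2. [cite: MochizukiSemiAnbd2006, §6 pp.69-73] -/
theorem profiniteNormalizers_and_outerIsoLifts_of_deltaTempNormallyTerminal (Ω : TemperedOrigin p)
    (hS : Ω.SpecializationIsoSystemHolds)
    (h : ∀ X : TemperedCurve p, Ω.IsHyperbolicCurveOrigin X →
      IsTempered X.PiTemp ∧ FirstCountableTopology X.PiTemp ∧ X.DeltaTempNormallyTerminal) :
    Ω.ProfiniteNormalizersHolds ∧ Ω.ProfiniteOuterIsoLiftsHolds :=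
  ⟨Ω.profiniteNormalizersHolds_of_deltaTempNormallyTerminal h,
    Ω.profiniteOuterIsoLiftsHolds_of_system_of_deltaTempNormallyTerminal hS h⟩

end TemperedOrigin

end Literature.AnabelianGeometry.SemiGraphs

end
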